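import Mathlib

/-!
# The first integral of the cone system and the elementary polar endgame (K35)

Solo seat `solo-NavierStokesRegularity-informed`, session 15; companion of `paper/axisymmetric-rigidity.md` §5k
(LEMMA 8.31 = first-integral reduction, LEMMA 8.32 = elementary endgame "Lemma E", replacing pieces P1a/P1b of the §5j programme
for THEOREM 8.30).

The reduced cone system (S_ε) in the inner chart (`' = d/dt`, `K = C/S`, `S' = C`, `C' = -ε S`, `ε S² + C² = 1`):
`V u' = εV² + s² - 2p - u - u²`, `V' = -3u - VK`, `V s' = -s(1 + 2u + VK)`, `p' = ε(u-1)V + (εV² + s²)K`.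
* `coneFirstIntegral_deriv`: `f := εV² + s² + 2p + u + u²` satisfies `V f' = -(1+2u) f` (for ANY `K`);
  `coneSwirlFlux_deriv`: so does `S̃ := s S`; `wronskian_ratio_const`: two solutions of `V g' = -k g` have `f' g - f g' = 0`
  (so `f/S̃` is constant on the polar sector); `coneFirstIntegral_coneValue`: at the swirling-cone data
  `(u, V, s, p) = (-1/2, 0, σ, (σ² + 1/4)/2)` with `S = σ` there, `f = 2σ² = 2 s S`. Hence `f = 2 s S` along the whole sector.
* `coneStrain_pFree`: with `2p = 2sS - εV² - s² - u - u²` the strain equation becomes `V u' = 2s(s - S) + 2εV²` — no `p`, no `u`.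
* `coneReduced_W/_St/_u`: in `W := -VS > 0`, `S̃ := sS`: `W' = 3uS`, `W S̃' = (1+2u) S̃ S`, `S W u' = -2(S̃(S̃ - S²) + εW²)`.
* `coneDeviation_m/_q/_a/_R`: deviations from the linear cone `E₁^ε` (`u_E = (3C²-1)/2`, `W_E = (3/2)S²C`, `S̃_E = S²`):
  `m := W - (3/2)S²C`, `q := S̃ - S²`, `a := u - u_E` obey `m' = 3aS`, `W q' = S(3C²q + 2a(S²+q) - 2Cm)`,
  `a' = -2S̃q/(SW) - 2εm/S`, and `R := S̃/W` obeys `R' = -(u-1)RS/W`.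
* `E1eps_firstIntegral`: the linear cone has `f = 2 s S` (constant `2`).
* `endgame_constants`: the arithmetic of Lemma E at `t_m = 1/20`, `ε ≤ 1/144` (`w = ε t_m² ≤ 1/57600`, `C ≥ 1 - w/2`, `S ≥ t(1 - w/6)`),
  `α = 5/2`, `ρ = 3/4`, bootstrap constant `θ₀ = 1/80`: `ρ̄ = 3/4`, `R̄ = (3/4)/(1 - 1/40)`, `κ̂ ≤ 1.1678`, `θ ≤ 0.01157 < 1/80`,
  and the side condition `t_m²(α + κ̂/5) < C_min (1 - θ₀)` (using `1/(2e) < 1/5`).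
The two calculus facts `∫₀^T t log(T/t) dt = T²/4`, `max t² log(T/t) = T²/(2e)` and the continuation argument are NOT formalised.
No new definitions; axioms: standard.
-/

namespace Summit.NavierStokesRegularity.NavierStokesRegularity.Theorems

/-- `f = εV² + s² + 2p + u + u²` satisfies `V f' = -(1+2u) f` along (S_ε), for an arbitrary coefficient `K`. -/
theorem coneFirstIntegral_deriv (u V s p ε K du dV ds dp : ℝ) (hV : V ≠ 0)
    (hu : du = (ε * V ^ 2 + s ^ 2 - 2 * p - u - u ^ 2) / V) (hdV : dV = -3 * u - V * K)
    (hs : ds = -s * (1 + 2 * u + V * K) / V) (hp : dp = ε * (u - 1) * V + (ε * V ^ 2 + s ^ 2) * K) :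
    V * (2 * ε * V * dV + 2 * s * ds + 2 * dp + (1 + 2 * u) * du)
      = -(1 + 2 * u) * (ε * V ^ 2 + s ^ 2 + 2 * p + u + u ^ 2) := by
  subst hu hdV hs hp
  field_simp
  ring

/-- `S̃ = s S` satisfies `V S̃' = -(1+2u) S̃` along (S_ε) (`K = C/S`, `S' = C`). -/
theorem coneSwirlFlux_deriv (u V s S C ds : ℝ) (hV : V ≠ 0) (hS : S ≠ 0)
    (hs : ds = -s * (1 + 2 * u + V * (C / S)) / V) :
    V * (ds * S + s * C) = -(1 + 2 * u) * (s * S) := by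
  subst hs
  field_simp
  ring

/-- Two solutions of the same first-order linear equation `V g' = -k g` (`V ≠ 0`) have vanishing Wronskian. -/
theorem wronskian_ratio_const (V k f g df dg : ℝ) (hV : V ≠ 0) (hf : V * df = -k * f) (hg : V * dg = -k * g) :
    df * g - f * dg = 0 := by
  have h : V * (df * g - f * dg) = 0 := by linear_combination g * hf - f * hg
  rcases mul_eq_zero.mp h with h | h
  · exact absurd h hV
  · exact h

/-- At the swirling-cone data `(u, V, s, p) = (-1/2, 0, σ, (σ²+1/4)/2)`, where `S = σ`: `f = 2σ² = 2 s S`. -/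
theorem coneFirstIntegral_coneValue (σ ε S₁ : ℝ) (hS : S₁ = σ) :
    ε * (0 : ℝ) ^ 2 + σ ^ 2 + 2 * ((σ ^ 2 + 1 / 4) / 2) + (-1 / 2) + (-1 / 2 : ℝ) ^ 2 = 2 * σ * S₁ := by
  subst hS
  ring

/-- With the first integral `2p = 2sS - εV² - s² - u - u²` the strain equation loses `p` and `u`:
`εV² + s² - 2p - u - u² = 2s(s - S) + 2εV²`. -/
theorem coneStrain_pFree (u V s p S ε : ℝ) (hp : 2 * p = 2 * s * S - ε * V ^ 2 - s ^ 2 - u - u ^ 2) :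
    ε * V ^ 2 + s ^ 2 - 2 * p - u - u ^ 2 = 2 * s * (s - S) + 2 * ε * V ^ 2 := by
  linear_combination (-1 : ℝ) * hp

/-- Reduced system, flux variable: `W := -VS` has `W' = 3uS`. -/
theorem coneReduced_W (u V S C dV : ℝ) (hS : S ≠ 0) (hdV : dV = -3 * u - V * (C / S)) :
    -(dV * S + V * C) = 3 * u * S := by
  subst hdV
  field_simp
  ring

/-- Reduced system, swirl flux: `W S̃' = (1+2u) S̃ S` with `W = -VS`, `S̃ = sS`. -/
theorem coneReduced_St (u V s S C ds : ℝ) (hV : V ≠ 0) (hS : S ≠ 0)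
    (hs : ds = -s * (1 + 2 * u + V * (C / S)) / V) :
    (-(V * S)) * (ds * S + s * C) = (1 + 2 * u) * (s * S) * S := by
  subst hs
  field_simp
  ring

/-- Reduced system, strain: `S W u' = -2(S̃(S̃ - S²) + εW²)` with `W = -VS`, `S̃ = sS`. -/
theorem coneReduced_u (V s S ε du : ℝ)
    (hu : V * du = 2 * s * (s - S) + 2 * ε * V ^ 2) :
    S * (-(V * S)) * du = -2 * ((s * S) * ((s * S) - S ^ 2) + ε * (-(V * S)) ^ 2) := by
  have : S * (-(V * S)) * du = -(S ^ 2) * (V * du) := by ring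
  rw [this, hu]
  ring

/-- Deviation from the linear cone, flux: `m := W - (3/2)S²C` has `m' = 3aS`, `a := u - (3C²-1)/2`
(uses `S' = C`, `C' = -εS`, `εS² + C² = 1`). -/
theorem coneDeviation_m (u S C ε dW : ℝ) (hPy : ε * S ^ 2 + C ^ 2 = 1) (hW : dW = 3 * u * S) :
    dW - 3 / 2 * (2 * S * C * C + S ^ 2 * (-(ε * S))) = 3 * (u - (3 * C ^ 2 - 1) / 2) * S := by
  subst hW
  linear_combination (3 / 2 : ℝ) * S * hPy

/-- Deviation from the linear cone, swirl: with `q := S̃ - S²`, `m := W - (3/2)S²C`, `a := u - (3C²-1)/2`: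
`W q' = S(3C²q + 2a(S²+q) - 2Cm)`. -/
theorem coneDeviation_q (u W St S C dSt : ℝ) (hSt : W * dSt = (1 + 2 * u) * St * S) :
    W * (dSt - 2 * S * C)
      = S * (3 * C ^ 2 * (St - S ^ 2) + 2 * (u - (3 * C ^ 2 - 1) / 2) * (S ^ 2 + (St - S ^ 2))
             - 2 * C * (W - 3 / 2 * S ^ 2 * C)) := by
  linear_combination hSt

/-- Deviation from the linear cone, strain: `a' = -2S̃q/(SW) - 2εm/S`. -/
theorem coneDeviation_a (W St S C ε du : ℝ) (hS : S ≠ 0) (hW : W ≠ 0)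
    (hu : S * W * du = -2 * (St * (St - S ^ 2) + ε * W ^ 2)) :
    du - 3 * C * (-(ε * S))
      = -2 * St * (St - S ^ 2) / (S * W) - 2 * ε * (W - 3 / 2 * S ^ 2 * C) / S := by
  have hSW : S * W ≠ 0 := mul_ne_zero hS hW
  have hdu : du = -2 * (St * (St - S ^ 2) + ε * W ^ 2) / (S * W) := by
    field_simp
    linear_combination hu
  rw [hdu]
  field_simp
  ring

/-- The ratio `R := S̃/W` obeys `R' = -(u-1) R S/W`. -/
theorem coneDeviation_R (u W St S dW dSt : ℝ) (hW : W ≠ 0)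
    (hdW : dW = 3 * u * S) (hSt : W * dSt = (1 + 2 * u) * St * S) :
    dSt / W - St * dW / W ^ 2 = -(u - 1) * (St / W) * S / W := by
  have hdSt : dSt = (1 + 2 * u) * St * S / W := by
    field_simp
    linear_combination hSt
  rw [hdSt, hdW]
  field_simp
  ring

/-- Along the linear cone `E₁^ε = ((3C²-1)/2, -(3/2)SC, S, -1 + S²/2 + (9/8)εS²)` the first integral has the constant `2`. -/
theorem E1eps_firstIntegral (S C ε : ℝ) (hPy : ε * S ^ 2 + C ^ 2 = 1) :
    ε * (-(3 / 2) * S * C) ^ 2 + S ^ 2 + 2 * (-1 + S ^ 2 / 2 + 9 / 8 * ε * S ^ 2)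
        + (3 * C ^ 2 - 1) / 2 + ((3 * C ^ 2 - 1) / 2) ^ 2 = 2 * S * S := by
  linear_combination (9 / 4 : ℝ) * (C ^ 2 + 1) * hPy

/-- The arithmetic of Lemma E (`t_m = 1/20`, `ε ≤ 1/144`, `w = 1/57600`, `C_min = 1 - w/2`, `s₀ = 1 - w/6`,
`α = 5/2`, `ρ = 3/4`, `θ₀ = 1/80`): `2/(3 C_min) ≤ 3/4 = ρ̄`; `R̄ = (3/4)/(1 - 2θ₀) ≥ 2/(3 C_min)`;
`κ̂ = (2 R̄ ρ̄ + 2/144)/s₀ ≤ 1.1678`; `θ = (3/2) t_m² (α + κ̂/2) ≤ 0.01157 < θ₀`; side condition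
`t_m² (α + κ̂/5) < C_min (1 - θ₀)`. -/
theorem endgame_constants :
    (2 / (3 * (1 - 1 / 57600 / 2)) : ℝ) ≤ 3 / 4
    ∧ (2 / (3 * (1 - 1 / 57600 / 2)) : ℝ) ≤ (3 / 4) / (1 - 2 / 80)
    ∧ ((2 * ((3 / 4) / (1 - 2 / 80)) * (3 / 4) + 2 / 144) / (1 - 1 / 57600 / 6) : ℝ) ≤ 1.1678
    ∧ ((3 / 2) * (1 / 20) ^ 2 * (5 / 2 + 1.1678 / 2) : ℝ) ≤ 0.01157
    ∧ (0.01157 : ℝ) < 1 / 80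
    ∧ ((1 / 20) ^ 2 * (5 / 2 + 1.1678 / 5) : ℝ) < (1 - 1 / 57600 / 2) * (1 - 1 / 80) := by
  refine ⟨by norm_num, by norm_num, by norm_num, by norm_num, by norm_num, by norm_num⟩

end Summit.NavierStokesRegularity.NavierStokesRegularity.Theorems
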